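import Mathlib

/-!
# The Hall form (V2) of the level-summed row (U) is closed under series composition
(seat mine-b, cell pub-perc-repro2; conjectures/MINE-B.md §19)

Two-colour pattern language (MINE-B.md §10, §17, §18): a pattern `(O, Y)` with a colouring `γ ⊆ Y`
has red and blue `s–t` max-flows `F_R, F_B`; the level-summed row **(U)** `#{F_R = 1} ≥ Σ_{F_R = 0} F_B`
is, on colour-swap symmetric families, the count `U′ = Σ ([r = 1 ∧ b ≥ 1] − r·[b = 0 ∧ r ≥ 2])`
(FlowSumClosure.lean, `uval_eq_uval'`).  Its **Hall form (V2)** asks that every UP-set of the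
configuration poset carry non-negative `U′`-mass — equivalently (Hall, and the colour swap) that
every configuration with `F_R = 0` and `F_B = a ≥ 2` own `a` private configurations below it with
`F_B = 1` and `F_R ≥ 1`.

A *labelled poset* is a finite preorder `X` with two labels `r b : X → ℕ` (red / blue flow).
Its signed weight is `ν′(x) = [r x = 1 ∧ b x ≥ 1] − r x · [b x = 0 ∧ r x ≥ 2]`, and `X` is
*up-dominated* (property (V2)) when every upper set has non-negative `ν′`-mass.  The *series
composition* of two labelled posets is the product preorder with the minima of the labels
(Menger at the glued terminal).  We prove that (V2) is closed under series composition, with the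
quantitative bound `ν′(W) ≥ ½ · #(W ∩ (B × B′))`, `B = {r = 1, b ≥ 1}`.  No symmetry of the
labels is used.
-/

namespace Summit.Ventures.PercRepro2.V2Closure

open Finset

variable {X Y : Type*}

/-- The signed weight `ν′(x) = [r x = 1 ∧ b x ≥ 1] − r x · [b x = 0 ∧ r x ≥ 2]`. -/
def nu' (r b : X → ℕ) (x : X) : ℤ :=
  (if r x = 1 ∧ 1 ≤ b x then 1 else 0) - (if b x = 0 ∧ 2 ≤ r x then (r x : ℤ) else 0)

/-- Up-set domination (V2): every upper set of `X` has non-negative `ν′`-mass. -/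
def UpDom [Preorder X] (r b : X → ℕ) : Prop :=
  ∀ V : Finset X, IsUpperSet (↑V : Set X) → 0 ≤ ∑ x ∈ V, nu' r b x

/-- Red label of the series composition: the minimum of the two red flows. -/
def serR (r : X → ℕ) (r' : Y → ℕ) (p : X × Y) : ℕ := min (r p.1) (r' p.2)

/-- Blue label of the series composition: the minimum of the two blue flows. -/
def serB (b : X → ℕ) (b' : Y → ℕ) (p : X × Y) : ℕ := min (b p.1) (b' p.2)

/-- Indicator of the class `B = {r = 1, b ≥ 1}` (the positive part of `ν′`). -/
def indB (r b : X → ℕ) (x : X) : ℤ := if r x = 1 ∧ 1 ≤ b x then 1 else 0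

/-- Indicator of the class `Q = {r ≥ 2, b ≥ 1}` (neutral configurations). -/
def indQ (r b : X → ℕ) (x : X) : ℤ := if 2 ≤ r x ∧ 1 ≤ b x then 1 else 0

/-- The weighted class `A = {b = 0, r ≥ 2}`, counted with weight `r` (the negative part of `ν′`). -/
def wA (r b : X → ℕ) (x : X) : ℤ := if b x = 0 ∧ 2 ≤ r x then (r x : ℤ) else 0

/-- Unweighted indicator of the class `A = {b = 0, r ≥ 2}`. -/
def indA (r b : X → ℕ) (x : X) : ℤ := if b x = 0 ∧ 2 ≤ r x then 1 else 0

/-- `ν′ = [B] − r·[A]` by definition. -/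
theorem nu'_eq (r b : X → ℕ) (x : X) : nu' r b x = indB r b x - wA r b x := rfl

/-- The indicator of `B` is non-negative. -/
theorem indB_nonneg (r b : X → ℕ) (x : X) : 0 ≤ indB r b x := by
  unfold indB; split_ifs <;> simp

/-- The indicator of `Q` is non-negative. -/
theorem indQ_nonneg (r b : X → ℕ) (x : X) : 0 ≤ indQ r b x := by
  unfold indQ; split_ifs <;> simp

/-- The weighted class `A` is non-negative. -/
theorem wA_nonneg (r b : X → ℕ) (x : X) : 0 ≤ wA r b x := by
  unfold wA; split_ifs <;> simp

/-- The indicator of `A` is non-negative. -/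
theorem indA_nonneg (r b : X → ℕ) (x : X) : 0 ≤ indA r b x := by
  unfold indA; split_ifs <;> simp

/-- On `A` the weight is at least `2`: `2 · [A] ≤ r · [A]`. -/
theorem two_indA_le_wA (r b : X → ℕ) (x : X) : 2 * indA r b x ≤ wA r b x := by
  unfold indA wA
  split_ifs with h
  · exact_mod_cast h.2
  · simp

/-- **Pointwise decomposition of the positive part.**  For the series labels,
`[B](x, y) = B B′ + B Q′ + Q B′`: the positive class is exactly `B×B′ ⊔ B×Q′ ⊔ Q×B′`. -/
theorem indB_ser (r b : X → ℕ) (r' b' : Y → ℕ) (x : X) (y : Y) :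
    indB (serR r r') (serB b b') (x, y)
      = indB r b x * indB r' b' y + indB r b x * indQ r' b' y + indQ r b x * indB r' b' y := by
  unfold indB indQ serR serB
  simp only
  split_ifs <;> omega

/-- **Pointwise bound on the negative part.**  The weight `min(r, r′) · [min b = 0 ∧ min r ≥ 2]`
is at most `r_x` on `A×Q′` and `A×A′`, and at most `r′_y` on `Q×A′`. -/
theorem wA_ser_le (r b : X → ℕ) (r' b' : Y → ℕ) (x : X) (y : Y) :
    wA (serR r r') (serB b b') (x, y)
      ≤ wA r b x * indQ r' b' y + indQ r b x * wA r' b' y + wA r b x * indA r' b' y := by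
  unfold wA indQ indA serR serB
  simp only
  split_ifs <;> push_cast <;> omega

/-- **Pointwise decomposition.**  `ν′(x, y) ≥ B B′ + B Q′ + Q B′ − A Q′ − Q A′ − A A′₀`. -/
theorem nu'_ser_ge (r b : X → ℕ) (r' b' : Y → ℕ) (x : X) (y : Y) :
    indB r b x * indB r' b' y + indB r b x * indQ r' b' y + indQ r b x * indB r' b' y
      - wA r b x * indQ r' b' y - indQ r b x * wA r' b' y - wA r b x * indA r' b' y
      ≤ nu' (serR r r') (serB b b') (x, y) := by
  rw [nu'_eq, indB_ser]
  have := wA_ser_le r b r' b' x y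
  linarith

section fibres

/-- The indicator of membership in `W`, as an integer. -/
def ind [DecidableEq X] [DecidableEq Y] (W : Finset (X × Y)) (x : X) (y : Y) : ℤ := if (x, y) ∈ W then 1 else 0

/-- The membership indicator is non-negative. -/
theorem ind_nonneg [DecidableEq X] [DecidableEq Y] (W : Finset (X × Y)) (x : X) (y : Y) : 0 ≤ ind W x y := by
  unfold ind; split_ifs <;> simp

/-- A sum over `W` of a product function is the double sum over `univ × univ` with the indicator. -/
theorem sum_W_eq [Fintype X] [Fintype Y] [DecidableEq X] [DecidableEq Y] (W : Finset (X × Y)) (f : X → ℤ) (g : Y → ℤ) :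
    ∑ p ∈ W, f p.1 * g p.2 = ∑ x, ∑ y, ind W x y * (f x * g y) := by
  rw [← Finset.sum_product' (s := (univ : Finset X)) (t := (univ : Finset Y))
    (f := fun x y => ind W x y * (f x * g y))]
  rw [← Finset.sum_filter_add_sum_filter_not (univ ×ˢ univ) (fun p => p ∈ W)]
  have h1 : ∑ p ∈ (univ ×ˢ univ).filter (fun p : X × Y => p ∈ W),
      ind W p.1 p.2 * (f p.1 * g p.2) = ∑ p ∈ W, f p.1 * g p.2 := by
    have : (univ ×ˢ univ).filter (fun p : X × Y => p ∈ W) = W := by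
      ext p; simp
    rw [this]
    apply Finset.sum_congr rfl
    intro p hp
    simp [ind, hp]
  have h2 : ∑ p ∈ (univ ×ˢ univ).filter (fun p : X × Y => ¬ p ∈ W),
      ind W p.1 p.2 * (f p.1 * g p.2) = 0 := by
    apply Finset.sum_eq_zero
    intro p hp
    simp only [Finset.mem_filter] at hp
    simp [ind, hp.2]
  rw [h1, h2, add_zero]

/-- The fibre `{x | (x, y) ∈ W}` of an upper set `W` is an upper set of `X`. -/
theorem fibre_fst_isUpperSet [Preorder X] [Preorder Y] [Fintype X] [DecidableEq X] [DecidableEq Y] (W : Finset (X × Y)) (hW : IsUpperSet (↑W : Set (X × Y))) (y : Y) :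
    IsUpperSet (↑(univ.filter (fun x : X => (x, y) ∈ W)) : Set X) := by
  intro x x' hxx' hx
  simp only [coe_filter, mem_univ, true_and, Set.mem_setOf_eq] at hx ⊢
  exact hW (Prod.mk_le_mk.2 ⟨hxx', le_rfl⟩) hx

/-- The fibre `{y | (x, y) ∈ W}` of an upper set `W` is an upper set of `Y`. -/
theorem fibre_snd_isUpperSet [Preorder X] [Preorder Y] [Fintype Y] [DecidableEq X] [DecidableEq Y] (W : Finset (X × Y)) (hW : IsUpperSet (↑W : Set (X × Y))) (x : X) :
    IsUpperSet (↑(univ.filter (fun y : Y => (x, y) ∈ W)) : Set Y) := by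
  intro y y' hyy' hy
  simp only [coe_filter, mem_univ, true_and, Set.mem_setOf_eq] at hy ⊢
  exact hW (Prod.mk_le_mk.2 ⟨le_rfl, hyy'⟩) hy

/-- Up-domination of `X`, read on the first-coordinate fibre over `y`:
`∑_x ind(x,y) · wA x ≤ ∑_x ind(x,y) · indB x`. -/
theorem fibre_fst_bound [Preorder X] [Preorder Y] [Fintype X] [Fintype Y] [DecidableEq X] [DecidableEq Y] (r b : X → ℕ) (hX : UpDom r b) (W : Finset (X × Y))
    (hW : IsUpperSet (↑W : Set (X × Y))) (y : Y) :
    ∑ x, ind W x y * wA r b x ≤ ∑ x, ind W x y * indB r b x := by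
  have h := hX (univ.filter (fun x : X => (x, y) ∈ W)) (fibre_fst_isUpperSet W hW y)
  rw [Finset.sum_filter] at h
  have e : ∀ x, ind W x y * indB r b x - ind W x y * wA r b x
      = if (x, y) ∈ W then nu' r b x else 0 := by
    intro x; unfold ind; split_ifs <;> simp [nu'_eq]
  have : ∑ x, ind W x y * indB r b x - ∑ x, ind W x y * wA r b x
      = ∑ x, (if (x, y) ∈ W then nu' r b x else 0) := by
    rw [← Finset.sum_sub_distrib]
    exact Finset.sum_congr rfl (fun x _ => e x)
  linarith

/-- Up-domination of `Y`, read on the second-coordinate fibre over `x`. -/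
theorem fibre_snd_bound [Preorder X] [Preorder Y] [Fintype X] [Fintype Y] [DecidableEq X] [DecidableEq Y] (r' b' : Y → ℕ) (hY : UpDom r' b') (W : Finset (X × Y))
    (hW : IsUpperSet (↑W : Set (X × Y))) (x : X) :
    ∑ y, ind W x y * wA r' b' y ≤ ∑ y, ind W x y * indB r' b' y := by
  have h := hY (univ.filter (fun y : Y => (x, y) ∈ W)) (fibre_snd_isUpperSet W hW x)
  rw [Finset.sum_filter] at h
  have e : ∀ y, ind W x y * indB r' b' y - ind W x y * wA r' b' y
      = if (x, y) ∈ W then nu' r' b' y else 0 := by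
    intro y; unfold ind; split_ifs <;> simp [nu'_eq]
  have : ∑ y, ind W x y * indB r' b' y - ∑ y, ind W x y * wA r' b' y
      = ∑ y, (if (x, y) ∈ W then nu' r' b' y else 0) := by
    rw [← Finset.sum_sub_distrib]
    exact Finset.sum_congr rfl (fun y _ => e y)
  linarith

/-- Bound (i): `∑_W A Q′ ≤ ∑_W B Q′` (fibres over `y`). -/
theorem bound_AQ [Preorder X] [Preorder Y] [Fintype X] [Fintype Y] [DecidableEq X] [DecidableEq Y] (r b : X → ℕ) (r' b' : Y → ℕ) (hX : UpDom r b) (W : Finset (X × Y))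
    (hW : IsUpperSet (↑W : Set (X × Y))) :
    ∑ p ∈ W, wA r b p.1 * indQ r' b' p.2 ≤ ∑ p ∈ W, indB r b p.1 * indQ r' b' p.2 := by
  rw [sum_W_eq, sum_W_eq, Finset.sum_comm, Finset.sum_comm (f := fun x y => ind W x y * (indB r b x * indQ r' b' y))]
  apply Finset.sum_le_sum
  intro y _
  have h := fibre_fst_bound r b hX W hW y
  have : ∀ f : X → ℤ, ∑ x, ind W x y * (f x * indQ r' b' y) = (∑ x, ind W x y * f x) * indQ r' b' y := by
    intro f; rw [Finset.sum_mul]; apply Finset.sum_congr rfl; intro x _; ring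
  rw [this, this]
  exact mul_le_mul_of_nonneg_right h (indQ_nonneg _ _ _)

/-- Bound (ii): `∑_W Q A′ ≤ ∑_W Q B′` (fibres over `x`). -/
theorem bound_QA [Preorder X] [Preorder Y] [Fintype X] [Fintype Y] [DecidableEq X] [DecidableEq Y] (r b : X → ℕ) (r' b' : Y → ℕ) (hY : UpDom r' b') (W : Finset (X × Y))
    (hW : IsUpperSet (↑W : Set (X × Y))) :
    ∑ p ∈ W, indQ r b p.1 * wA r' b' p.2 ≤ ∑ p ∈ W, indQ r b p.1 * indB r' b' p.2 := by
  rw [sum_W_eq, sum_W_eq]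
  apply Finset.sum_le_sum
  intro x _
  have h := fibre_snd_bound r' b' hY W hW x
  have : ∀ g : Y → ℤ, ∑ y, ind W x y * (indQ r b x * g y) = indQ r b x * (∑ y, ind W x y * g y) := by
    intro g; rw [Finset.mul_sum]; apply Finset.sum_congr rfl; intro y _; ring
  rw [this, this]
  exact mul_le_mul_of_nonneg_left h (indQ_nonneg _ _ _)

/-- Bound (iii): `2 · ∑_W A A′₀ ≤ ∑_W B B′` (fibres over `y`, then over `x` with the factor `2`). -/
theorem bound_AA [Preorder X] [Preorder Y] [Fintype X] [Fintype Y] [DecidableEq X] [DecidableEq Y] (r b : X → ℕ) (r' b' : Y → ℕ) (hX : UpDom r b) (hY : UpDom r' b')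
    (W : Finset (X × Y)) (hW : IsUpperSet (↑W : Set (X × Y))) :
    2 * ∑ p ∈ W, wA r b p.1 * indA r' b' p.2 ≤ ∑ p ∈ W, indB r b p.1 * indB r' b' p.2 := by
  -- step 1: A A′₀ ≤ B A′₀ (fibres over y)
  have s1 : ∑ p ∈ W, wA r b p.1 * indA r' b' p.2 ≤ ∑ p ∈ W, indB r b p.1 * indA r' b' p.2 := by
    rw [sum_W_eq, sum_W_eq, Finset.sum_comm, Finset.sum_comm (f := fun x y => ind W x y * (indB r b x * indA r' b' y))]
    apply Finset.sum_le_sum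
    intro y _
    have h := fibre_fst_bound r b hX W hW y
    have : ∀ f : X → ℤ, ∑ x, ind W x y * (f x * indA r' b' y) = (∑ x, ind W x y * f x) * indA r' b' y := by
      intro f; rw [Finset.sum_mul]; apply Finset.sum_congr rfl; intro x _; ring
    rw [this, this]
    exact mul_le_mul_of_nonneg_right h (indA_nonneg _ _ _)
  -- step 2: 2 B A′₀ ≤ B A′ ≤ B B′ (fibres over x)
  have s2 : 2 * ∑ p ∈ W, indB r b p.1 * indA r' b' p.2 ≤ ∑ p ∈ W, indB r b p.1 * indB r' b' p.2 := by
    rw [sum_W_eq, sum_W_eq, Finset.mul_sum]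
    apply Finset.sum_le_sum
    intro x _
    have h := fibre_snd_bound r' b' hY W hW x
    have e1 : ∀ g : Y → ℤ, ∑ y, ind W x y * (indB r b x * g y) = indB r b x * (∑ y, ind W x y * g y) := by
      intro g; rw [Finset.mul_sum]; apply Finset.sum_congr rfl; intro y _; ring
    rw [e1, e1, ← mul_assoc, mul_comm 2, mul_assoc]
    apply mul_le_mul_of_nonneg_left _ (indB_nonneg _ _ _)
    calc 2 * ∑ y, ind W x y * indA r' b' y = ∑ y, ind W x y * (2 * indA r' b' y) := by
          rw [Finset.mul_sum]; apply Finset.sum_congr rfl; intro y _; ring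
      _ ≤ ∑ y, ind W x y * wA r' b' y := by
          apply Finset.sum_le_sum; intro y _
          exact mul_le_mul_of_nonneg_left (two_indA_le_wA _ _ _) (ind_nonneg _ _ _)
      _ ≤ ∑ y, ind W x y * indB r' b' y := h
  linarith

/-- **Series closure of (V2), quantitative form.**  For an upper set `W` of the series composition,
`2 · ν′(W) ≥ #(W ∩ (B × B′))` (as a weighted count). -/
theorem two_mul_sum_nu'_ser_ge [Preorder X] [Preorder Y] [Fintype X] [Fintype Y] [DecidableEq X] [DecidableEq Y] (r b : X → ℕ) (r' b' : Y → ℕ) (hX : UpDom r b) (hY : UpDom r' b')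
    (W : Finset (X × Y)) (hW : IsUpperSet (↑W : Set (X × Y))) :
    ∑ p ∈ W, indB r b p.1 * indB r' b' p.2 ≤ 2 * ∑ p ∈ W, nu' (serR r r') (serB b b') p := by
  have hpt : ∑ p ∈ W, (indB r b p.1 * indB r' b' p.2 + indB r b p.1 * indQ r' b' p.2
      + indQ r b p.1 * indB r' b' p.2 - wA r b p.1 * indQ r' b' p.2 - indQ r b p.1 * wA r' b' p.2
      - wA r b p.1 * indA r' b' p.2) ≤ ∑ p ∈ W, nu' (serR r r') (serB b b') p := by
    apply Finset.sum_le_sum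
    intro p _
    exact nu'_ser_ge r b r' b' p.1 p.2
  simp only [Finset.sum_sub_distrib, Finset.sum_add_distrib] at hpt
  have h1 := bound_AQ r b r' b' hX W hW
  have h2 := bound_QA r b r' b' hY W hW
  have h3 := bound_AA r b r' b' hX hY W hW
  linarith

/-- **Theorem A (series closure of (V2)).**  If both factors are up-dominated, so is their series
composition. -/
theorem upDom_ser [Preorder X] [Preorder Y] [Fintype X] [Fintype Y] [DecidableEq X] [DecidableEq Y] (r b : X → ℕ) (r' b' : Y → ℕ) (hX : UpDom r b) (hY : UpDom r' b') :
    UpDom (serR r r') (serB b b') := by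
  intro W hW
  have h := two_mul_sum_nu'_ser_ge r b r' b' hX hY W hW
  have h0 : 0 ≤ ∑ p ∈ W, indB r b p.1 * indB r' b' p.2 :=
    Finset.sum_nonneg (fun p _ => mul_nonneg (indB_nonneg _ _ _) (indB_nonneg _ _ _))
  linarith

end fibres

end Summit.Ventures.PercRepro2.V2Closure
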